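import Literature.AlgebraicGeometry.Modules.PushforwardAffineBaseChange
import Literature.AlgebraicGeometry.KTheory.PullbackVectorBundle
import Literature.AlgebraicGeometry.AbelianSchemes.RigidifiedLineBundleComap
import Literature.AlgebraicGeometry.Modules.VectorBundleFiniteLocallyFree
import HarnessLib

/-!
# The formation of `p_*𝒪_X` commutes with base change for `p` affine: `b^*(p_*𝒪_X) ≅ pT_*𝒪_{X ×_S T}`

Topic `Literature/AlgebraicGeometry/Modules`; theorems only (no definition, no named fact, no instance, no `sorry`).  Cell
hodgecm-mathlib, F-DAG (h6)/(ii) (B-plan1 (g15) 05:17:19Z): the corollaries of ★ `Modules/PushforwardAffineBaseChange` (affine base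
change `b^*(p_*G) ≅ pT_*(pr^*G)`, [StacksProject, Tag 02KG] / [GortzWedhorn2020] Prop. 12.6 (1)) at `G := 𝒪_X`, combined with
`pr^*𝒪_X ≅ 𝒪_{X_T}` (Mathlib `SheafOfModules.pullbackObjUnitToUnit`, an isomorphism since `Opens.map` is final, ★
`KTheory.final_opensMap`).  [GortzWedhorn2020] after Def. 12.18: «If `f` is finite, the formation of `f_*𝒪_X` commutes with base
change by Proposition 12.6» — the input of the rank / degree arguments for finite locally free morphisms (GW I Cor. 12.20).
HC_CM is proved only modulo the 7 printed citations until rung 0 closes; nothing here is about HC.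

* **`isIso_pushforwardBaseChangeHom_unit`** (`b^*(p_*𝒪_X) ⟶ pT_*(pr^*𝒪_X)` iso, `p` affine),
  **`nonempty_pullback_pushforward_unit_iso`** (`b^*(p_*𝒪_X) ≅ pT_*𝒪_{X_T}`);
* `isFiniteLocallyFree_pushforward_unit_baseChange` — if `p_*𝒪_X` is finite locally free then so is `pT_*𝒪_{X_T}` (for `p` affine:
  pull back and transport along the iso).

## References
* [GortzWedhorn2020] U. Görtz, T. Wedhorn, *Algebraic Geometry I: Schemes*, 2nd ed. (2020), Proposition 12.6 (1) and the sentence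
  after Definition 12.18 (formation of `f_*𝒪_X` commutes with base change for `f` finite), Cor. 12.20.
* [StacksProject] The Stacks Project, Tag 02KG (affine base change).
-/

noncomputable section

open CategoryTheory CategoryTheory.Limits AlgebraicGeometry TopologicalSpace Opposite

universe u

namespace Literature.AlgebraicGeometry.Modules

open Literature.AlgebraicGeometry.Motives

variable {X S T XT : Scheme.{u}} {pr : XT ⟶ X} {pT : XT ⟶ T} {p : X ⟶ S} {b : T ⟶ S} (H : IsPullback pr pT p b)

/-- **`b^*(p_*𝒪_X) ⟶ pT_*(pr^*𝒪_X)` is an isomorphism for `p` affine** (★ affine base change at `G := 𝒪_X`).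
[cite: GortzWedhorn2020, Proposition 12.6 (1)] [cite: StacksProject, Tag 02KG] -/
theorem isIso_pushforwardBaseChangeHom_unit [IsAffineHom p] :
    IsIso (pushforwardBaseChangeHom H.w (unitModule X)) :=
  isIso_pushforwardBaseChangeHom_of_isAffineHom H _ IsAffineLocalizing.unit

include H in
/-- **The formation of `p_*𝒪_X` commutes with base change for `p` affine**: `b^*(p_*𝒪_X) ≅ pT_*𝒪_{X_T}`, the affine
base-change isomorphism followed by `pT_*` of `pr^*𝒪_X ≅ 𝒪_{X_T}` (★ `AbelianSchemeOver.RigidifiedLineBundle.pullbackUnitIso` = Mathlib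
`pullbackObjUnitToUnit`, an iso since `Opens.map` is final). [cite: GortzWedhorn2020, Proposition 12.6 (1)] [cite: StacksProject, Tag 02KG] -/
theorem nonempty_pullback_pushforward_unit_iso [IsAffineHom p] :
    Nonempty ((Scheme.Modules.pullback b).obj ((Scheme.Modules.pushforward p).obj (unitModule X)) ≅
      (Scheme.Modules.pushforward pT).obj (unitModule XT)) :=
  haveI := isIso_pushforwardBaseChangeHom_unit H
  ⟨asIso (pushforwardBaseChangeHom H.w (unitModule X)) ≪≫
    (Scheme.Modules.pushforward pT).mapIso (AbelianSchemes.AbelianSchemeOver.RigidifiedLineBundle.pullbackUnitIso pr)⟩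

include H in
/-- **If `p_*𝒪_X` is finite locally free then so is `pT_*𝒪_{X_T}`** for `p` affine (finite locally free morphisms are stable under
base change, module form: pull back ★ `IsFiniteLocallyFree.pullback` and transport along `b^*(p_*𝒪_X) ≅ pT_*𝒪_{X_T}`).
[cite: GortzWedhorn2020, Proposition 12.6 (1)] -/
theorem isFiniteLocallyFree_pushforward_unit_baseChange [IsAffineHom p]
    (hflf : IsFiniteLocallyFree ((Scheme.Modules.pushforward p).obj (unitModule X))) :
    IsFiniteLocallyFree ((Scheme.Modules.pushforward pT).obj (unitModule XT)) := by
  obtain ⟨e⟩ := nonempty_pullback_pushforward_unit_iso H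
  exact isFiniteLocallyFree_of_iso e (hflf.pullback b)

end Literature.AlgebraicGeometry.Modules

end
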